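import Summits.CriticalPhenomena.PercolationContinuityZ3.Theorems.PercNearOneGluingNoHeavyLowerTailSahiThreeCopy
import Literature.Combinatorics.Sahi2008.UnderlyingIndependents
import Summits.CriticalPhenomena.PercolationContinuityZ3.Theorems.SahiConjecture

/-!
# `NoHeavyLowerTail` (crux stmt-CriticalPhenomena-4575), Sahi programme: **THE FOUR-COPY (tensor-Bernstein) FORM OF SAHI'S `E₄`** —
# `E₄^{coin q}(f₀,f₁,f₂,f₃) = Σ_{b ∈ {0,…,4}^d} Π q_i^{b_i}(1−q_i)^{4−b_i} · c⁴_b(f)`, the census's conjecture 4C-SAHI as an obligation, and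
# `FourCopySahi → SahiConjecture 4`

Support file (Sahi cell, seat `prim-sahi-p1`, generation 53; `--supports stmt-CriticalPhenomena-4575`); the order-4 companion of
`…SahiThreeCopy` / `…SahiThreeCopyBernstein`.  Pure proofs plus bookkeeping definitions (`IsArr4`, `N4`, `tc4`, `bern4`, `profile4`,
`FourCopySahi`); no `sorry`, standard axioms.

* `N4 b f g h k = Σ_{x+y+z+w=b} f(x)g(y)h(z)k(w)` and the FOUR-COPY SAHI COEFFICIENT `c⁴_b = tc4 b` read off Lieb–Sahi's fifteen-term `E₄`
  [LiebSahi2021, display after Def. 3.1] (the tree's `sahiE_four`):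
  `c⁴_b = 6N(fghk) − 2ΣN(f;ghk) + ΣN(f;g;hk) − ΣN(fg;hk) − N(f;g;h;k)`.
* ★ `sahiE_four_coinWeight`: the identity above for ALL real `q` and ALL real `f₀,…,f₃` on `{0,1}^d` (four independent copies grouped by
  their profile; `bern4_profile4`, `sum4_coin_eq`).
* `FourCopySahi` (`@[conjecture]`, CENSUS §175 W197i: `c⁴_b(1_A,1_B,1_C,1_D) ≥ 0` for up-sets; exhaustive on `{0,1}^d`, `d ≤ 4`: 2.15·10¹⁰ (multiset, profile)
  pairs, 0 negative) — OPEN, an obligation; `fourCopySahi → SahiPositive (coinWeight q) 4` for every cube and `q ∈ [0,1]^d`, hence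
  ★ `sahiConjecture_four_of_fourCopySahi : FourCopySahi → SahiConjecture 4` (every FKG poset, underlying independents) and, by the hierarchy
  `C₄ ⇒ C₃` (`sahiConjecture_antitone`-style, here via `SahiPositive.of_succ`), `FourCopySahi → SahiConjecture 3`.
Nothing conjectural is asserted. [this work; conjecture: CENSUS §175 W197 (prim-sahi-census gen 54)]
-/

namespace Summit.CriticalPhenomena.PercolationContinuityZ3.Theorems.SahiThreeCopy

open Finset Function Literature.Combinatorics.Sahi2008
open scoped BigOperators

noncomputable section

variable {d : ℕ}

/-! ### §1 Four-copy arrangements and functionals -/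

/-- `(x,y,z,w)` is a four-copy arrangement of the profile `b`: `x_i + y_i + z_i + w_i = b_i`. [this work; CENSUS §175 W197] -/
def IsArr4 (b : Fin d → ℕ) (x y z w : Pt d) : Prop := ∀ i, (x i).toNat + (y i).toNat + (z i).toNat + (w i).toNat = b i

/-- `IsArr4` is decidable. [this work] -/
instance instDecidableIsArr4 (b : Fin d → ℕ) (x y z w : Pt d) : Decidable (IsArr4 b x y z w) := by
  unfold IsArr4; infer_instance

/-- The FOUR-COPY FUNCTIONAL `N⁴_b(f;g;h;k) = Σ_{x+y+z+w=b} f(x)g(y)h(z)k(w)`. [this work; CENSUS §175 W197] -/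
def N4 (b : Fin d → ℕ) (f g h k : Pt d → ℝ) : ℝ :=
  ∑ x : Pt d, ∑ y : Pt d, ∑ z : Pt d, ∑ w : Pt d, if IsArr4 b x y z w then f x * g y * h z * k w else 0

/-- The FOUR-COPY SAHI COEFFICIENT, read off Lieb–Sahi's fifteen-term `E₄` (same grouping as the tree's `sahiE_four`):
`c⁴_b = 6N(abcd) − 2[N(a;bcd)+…] + [N(a;b;cd)+…] − [N(ab;cd)+…] − N(a;b;c;d)`. [this work; LiebSahi2021, Def. 3.1 display] -/
def tc4 (β : Fin d → ℕ) (a b c e : Pt d → ℝ) : ℝ :=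
  6 * N4 β (a * b * c * e) 1 1 1
  - 2 * (N4 β a (b * c * e) 1 1 + N4 β b (a * c * e) 1 1 + N4 β c (a * b * e) 1 1 + N4 β e (a * b * c) 1 1)
  + (N4 β a b (c * e) 1 + N4 β a c (b * e) 1 + N4 β a e (b * c) 1 + N4 β b c (a * e) 1 + N4 β b e (a * c) 1 +
      N4 β c e (a * b) 1)
  - (N4 β (a * b) (c * e) 1 1 + N4 β (a * c) (b * e) 1 1 + N4 β (a * e) (b * c) 1 1)
  - N4 β a b c e

/-! ### §2 Four independent copies grouped by profile -/

/-- The degree-`(4,…,4)` Bernstein monomial `m⁴_b(q) = Π_i q_i^{b_i}(1−q_i)^{4−b_i}`. [this work] -/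
def bern4 (q : Fin d → ℝ) (b : Fin d → ℕ) : ℝ := ∏ i, q i ^ b i * (1 - q i) ^ (4 - b i)

/-- `m⁴_b(q) ≥ 0` for `q ∈ [0,1]^d`. [this work] -/
theorem bern4_nonneg {q : Fin d → ℝ} (hq : ∀ i, 0 ≤ q i ∧ q i ≤ 1) (b : Fin d → ℕ) : 0 ≤ bern4 q b :=
  prod_nonneg fun i _ => mul_nonneg (pow_nonneg (hq i).1 _) (pow_nonneg (sub_nonneg.2 (hq i).2) _)

/-- The four-copy profile `x + y + z + w ∈ {0,…,4}^d`. [this work] -/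
def profile4 (x y z w : Pt d) : Fin d → Fin 5 := fun i =>
  ⟨(x i).toNat + (y i).toNat + (z i).toNat + (w i).toNat, by
    have h1 := Bool.toNat_le (x i); have h2 := Bool.toNat_le (y i); have h3 := Bool.toNat_le (z i)
    have h4 := Bool.toNat_le (w i); omega⟩

/-- A quadruple is an arrangement of `b ∈ {0,…,4}^d` iff `b` is its profile. [this work] -/
theorem isArr4_coe_iff (b : Fin d → Fin 5) (x y z w : Pt d) :
    IsArr4 (fun i => ((b i : Fin 5) : ℕ)) x y z w ↔ profile4 x y z w = b := by
  constructor
  · intro h; funext i; exact Fin.ext (h i)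
  · rintro rfl i; rfl

/-- `w(x)w(y)w(z)w(u) = m⁴_{x+y+z+u}(q)` for the coin weight. [this work] -/
theorem bern4_profile4 (q : Fin d → ℝ) (x y z w : Pt d) :
    bern4 q (fun i => ((profile4 x y z w i : Fin 5) : ℕ)) = coinWeight q x * coinWeight q y * coinWeight q z * coinWeight q w := by
  unfold bern4 coinWeight
  rw [← prod_mul_distrib, ← prod_mul_distrib, ← prod_mul_distrib]
  refine prod_congr rfl fun i _ => ?_
  simp only [profile4]
  cases x i <;> cases y i <;> cases z i <;> cases w i <;>
    simp only [Bool.toNat_true, Bool.toNat_false, Nat.reduceAdd, Nat.reduceSub, if_true, Bool.false_eq_true,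
      if_false, pow_zero, pow_one, mul_one, one_mul] <;> ring

/-- For a fixed quadruple, summing `m⁴_b · F` over the profiles it is an arrangement of picks out the product weight times `F`. [this work] -/
theorem sum_profile4_ite (q : Fin d → ℝ) (F : ℝ) (x y z w : Pt d) :
    ∑ b : Fin d → Fin 5, (if IsArr4 (fun i => ((b i : Fin 5) : ℕ)) x y z w then bern4 q (fun i => ((b i : Fin 5) : ℕ)) * F else 0) =
      coinWeight q x * coinWeight q y * coinWeight q z * coinWeight q w * F := by
  simp only [isArr4_coe_iff]
  rw [Fintype.sum_ite_eq, bern4_profile4]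

/-- Reordering a fivefold sum (plumbing). [folklore] -/
theorem sum5_comm_last (G : Pt d → Pt d → Pt d → Pt d → (Fin d → Fin 5) → ℝ) :
    ∑ x : Pt d, ∑ y : Pt d, ∑ z : Pt d, ∑ w : Pt d, ∑ b : Fin d → Fin 5, G x y z w b =
      ∑ b : Fin d → Fin 5, ∑ x : Pt d, ∑ y : Pt d, ∑ z : Pt d, ∑ w : Pt d, G x y z w b := by
  calc (∑ x : Pt d, ∑ y : Pt d, ∑ z : Pt d, ∑ w : Pt d, ∑ b : Fin d → Fin 5, G x y z w b)
      = ∑ x : Pt d, ∑ y : Pt d, ∑ z : Pt d, ∑ b : Fin d → Fin 5, ∑ w : Pt d, G x y z w b :=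
        sum_congr rfl fun x _ => sum_congr rfl fun y _ => sum_congr rfl fun z _ => sum_comm
    _ = ∑ x : Pt d, ∑ y : Pt d, ∑ b : Fin d → Fin 5, ∑ z : Pt d, ∑ w : Pt d, G x y z w b :=
        sum_congr rfl fun x _ => sum_congr rfl fun y _ => sum_comm
    _ = ∑ x : Pt d, ∑ b : Fin d → Fin 5, ∑ y : Pt d, ∑ z : Pt d, ∑ w : Pt d, G x y z w b := sum_congr rfl fun x _ => sum_comm
    _ = ∑ b : Fin d → Fin 5, ∑ x : Pt d, ∑ y : Pt d, ∑ z : Pt d, ∑ w : Pt d, G x y z w b := sum_comm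

/-- **Four independent copies, grouped by profile**:
`Σ_{x,y,z,w} w(x)w(y)w(z)w(w)·u(x)v(y)r(z)s(w) = Σ_{b∈{0,…,4}^d} m⁴_b(q)·N⁴_b(u;v;r;s)`. [this work] -/
theorem sum4_coin_eq (q : Fin d → ℝ) (u v r s : Pt d → ℝ) :
    ∑ x, ∑ y, ∑ z, ∑ w, coinWeight q x * coinWeight q y * coinWeight q z * coinWeight q w * (u x * v y * r z * s w) =
      ∑ b : Fin d → Fin 5, bern4 q (fun i => ((b i : Fin 5) : ℕ)) * N4 (fun i => ((b i : Fin 5) : ℕ)) u v r s := by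
  have h1 : ∀ x y z w : Pt d, coinWeight q x * coinWeight q y * coinWeight q z * coinWeight q w * (u x * v y * r z * s w) =
      ∑ b : Fin d → Fin 5, (if IsArr4 (fun i => ((b i : Fin 5) : ℕ)) x y z w then
        bern4 q (fun i => ((b i : Fin 5) : ℕ)) * (u x * v y * r z * s w) else 0) :=
    fun x y z w => (sum_profile4_ite q (u x * v y * r z * s w) x y z w).symm
  simp only [h1]
  unfold N4
  simp only [mul_sum, mul_ite, mul_zero]
  exact sum5_comm_last _

/-- `E(u)` as a four-copy sum (three idle copies). [this work] -/
theorem ex_coin_eq_sum4 (q : Fin d → ℝ) (u : Pt d → ℝ) :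
    ex (coinWeight q) u = ∑ x, ∑ y, ∑ z, ∑ w, coinWeight q x * coinWeight q y * coinWeight q z * coinWeight q w *
      (u x * (1 : Pt d → ℝ) y * (1 : Pt d → ℝ) z * (1 : Pt d → ℝ) w) := by
  simp only [Pi.one_apply, mul_one]
  rw [ex]
  refine sum_congr rfl fun x _ => ?_
  calc coinWeight q x * u x
      = coinWeight q x * u x * (((∑ y, coinWeight q y) * (∑ z, coinWeight q z)) * (∑ w, coinWeight q w)) := by
        rw [sum_coinWeight, mul_one, mul_one, mul_one]
    _ = ∑ y, ∑ z, ∑ w, coinWeight q x * coinWeight q y * coinWeight q z * coinWeight q w * u x := by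
        rw [sum_mul_sum, sum_mul, mul_sum]
        refine sum_congr rfl fun y _ => ?_
        rw [sum_mul, mul_sum]
        refine sum_congr rfl fun z _ => ?_
        rw [mul_sum, mul_sum]
        exact sum_congr rfl fun w _ => by ring

/-- `E(u)E(v)` as a four-copy sum (two idle copies). [this work] -/
theorem ex2_coin_eq_sum4 (q : Fin d → ℝ) (u v : Pt d → ℝ) :
    ex (coinWeight q) u * ex (coinWeight q) v = ∑ x, ∑ y, ∑ z, ∑ w, coinWeight q x * coinWeight q y * coinWeight q z *
      coinWeight q w * (u x * v y * (1 : Pt d → ℝ) z * (1 : Pt d → ℝ) w) := by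
  simp only [Pi.one_apply, mul_one]
  rw [ex, ex, sum_mul_sum]
  refine sum_congr rfl fun x _ => sum_congr rfl fun y _ => ?_
  calc coinWeight q x * u x * (coinWeight q y * v y)
      = coinWeight q x * u x * (coinWeight q y * v y) * ((∑ z, coinWeight q z) * (∑ w, coinWeight q w)) := by
        rw [sum_coinWeight, mul_one, mul_one]
    _ = ∑ z, ∑ w, coinWeight q x * coinWeight q y * coinWeight q z * coinWeight q w * (u x * v y) := by
        rw [sum_mul_sum, mul_sum]
        refine sum_congr rfl fun z _ => ?_
        rw [mul_sum]
        exact sum_congr rfl fun w _ => by ring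

/-- `E(u)E(v)E(r)` as a four-copy sum (one idle copy). [this work] -/
theorem ex3_coin_eq_sum4 (q : Fin d → ℝ) (u v r : Pt d → ℝ) :
    ex (coinWeight q) u * ex (coinWeight q) v * ex (coinWeight q) r = ∑ x, ∑ y, ∑ z, ∑ w, coinWeight q x * coinWeight q y *
      coinWeight q z * coinWeight q w * (u x * v y * r z * (1 : Pt d → ℝ) w) := by
  simp only [Pi.one_apply, mul_one]
  rw [ex, ex, ex, sum_mul_sum, sum_mul]
  refine sum_congr rfl fun x _ => ?_
  rw [sum_mul]
  refine sum_congr rfl fun y _ => ?_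
  rw [mul_sum]
  refine sum_congr rfl fun z _ => ?_
  calc coinWeight q x * u x * (coinWeight q y * v y) * (coinWeight q z * r z)
      = coinWeight q x * u x * (coinWeight q y * v y) * (coinWeight q z * r z) * (∑ w, coinWeight q w) := by
        rw [sum_coinWeight, mul_one]
    _ = ∑ w, coinWeight q x * coinWeight q y * coinWeight q z * coinWeight q w * (u x * v y * r z) := by
        rw [mul_sum]
        exact sum_congr rfl fun w _ => by ring

/-- `E(u)E(v)E(r)E(s)` as a four-copy sum. [this work] -/
theorem ex4_coin_eq_sum4 (q : Fin d → ℝ) (u v r s : Pt d → ℝ) :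
    ex (coinWeight q) u * ex (coinWeight q) v * ex (coinWeight q) r * ex (coinWeight q) s =
      ∑ x, ∑ y, ∑ z, ∑ w, coinWeight q x * coinWeight q y * coinWeight q z * coinWeight q w * (u x * v y * r z * s w) := by
  rw [ex, ex, ex, ex, sum_mul_sum, sum_mul, sum_mul]
  refine sum_congr rfl fun x _ => ?_
  rw [sum_mul, sum_mul]
  refine sum_congr rfl fun y _ => ?_
  rw [mul_assoc, sum_mul_sum, mul_sum]
  refine sum_congr rfl fun z _ => ?_
  rw [mul_sum]
  exact sum_congr rfl fun w _ => by ring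

/-! ### §3 The four-copy expansion of `E₄` -/

/-- **`E₄^{coin q}(a,b,c,e) = Σ_{β ∈ {0,…,4}^d} m⁴_β(q) · c⁴_β(a,b,c,e)`** for ALL real `q, a, b, c, e` — Lieb–Sahi's `E₄`
[LiebSahi2021, Def. 3.1 display] under a coin weight in the minimal tensor-Bernstein multidegree. [this work; CENSUS §175 W197i] -/
theorem sahiE_four_coinWeight (q : Fin d → ℝ) (a b c e : Pt d → ℝ) :
    sahiE (coinWeight q) 4 ![a, b, c, e] =
      ∑ β : Fin d → Fin 5, bern4 q (fun i => ((β i : Fin 5) : ℕ)) * tc4 (fun i => ((β i : Fin 5) : ℕ)) a b c e := by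
  have T1 : ex (coinWeight q) (a * b * c * e) = ∑ β : Fin d → Fin 5,
      bern4 q (fun i => ((β i : Fin 5) : ℕ)) * N4 (fun i => ((β i : Fin 5) : ℕ)) (a * b * c * e) 1 1 1 := by
    rw [ex_coin_eq_sum4, sum4_coin_eq]
  have T2 : ∀ u v : Pt d → ℝ, ex (coinWeight q) u * ex (coinWeight q) v = ∑ β : Fin d → Fin 5,
      bern4 q (fun i => ((β i : Fin 5) : ℕ)) * N4 (fun i => ((β i : Fin 5) : ℕ)) u v 1 1 := by
    intro u v; rw [ex2_coin_eq_sum4, sum4_coin_eq]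
  have T3 : ∀ u v r : Pt d → ℝ, ex (coinWeight q) u * ex (coinWeight q) v * ex (coinWeight q) r = ∑ β : Fin d → Fin 5,
      bern4 q (fun i => ((β i : Fin 5) : ℕ)) * N4 (fun i => ((β i : Fin 5) : ℕ)) u v r 1 := by
    intro u v r; rw [ex3_coin_eq_sum4, sum4_coin_eq]
  have T4 : ex (coinWeight q) a * ex (coinWeight q) b * ex (coinWeight q) c * ex (coinWeight q) e = ∑ β : Fin d → Fin 5,
      bern4 q (fun i => ((β i : Fin 5) : ℕ)) * N4 (fun i => ((β i : Fin 5) : ℕ)) a b c e := by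
    rw [ex4_coin_eq_sum4, sum4_coin_eq]
  have eR : ∀ β : Fin d → ℕ, bern4 q β * tc4 β a b c e =
      6 * (bern4 q β * N4 β (a * b * c * e) 1 1 1)
      - 2 * (bern4 q β * N4 β a (b * c * e) 1 1 + bern4 q β * N4 β b (a * c * e) 1 1 + bern4 q β * N4 β c (a * b * e) 1 1 +
          bern4 q β * N4 β e (a * b * c) 1 1)
      + (bern4 q β * N4 β a b (c * e) 1 + bern4 q β * N4 β a c (b * e) 1 + bern4 q β * N4 β a e (b * c) 1 +
          bern4 q β * N4 β b c (a * e) 1 + bern4 q β * N4 β b e (a * c) 1 + bern4 q β * N4 β c e (a * b) 1)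
      - (bern4 q β * N4 β (a * b) (c * e) 1 1 + bern4 q β * N4 β (a * c) (b * e) 1 1 + bern4 q β * N4 β (a * e) (b * c) 1 1)
      - bern4 q β * N4 β a b c e := by
    intro β; unfold tc4; ring
  simp only [eR, sum_add_distrib, sum_sub_distrib, ← mul_sum]
  rw [sahiE_four, T1, T4, T2 a (b * c * e), T2 b (a * c * e), T2 c (a * b * e), T2 e (a * b * c), T3 a b (c * e), T3 a c (b * e),
    T3 a e (b * c), T3 b c (a * e), T3 b e (a * c), T3 c e (a * b), T2 (a * b) (c * e), T2 (a * c) (b * e), T2 (a * e) (b * c)]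

/-- **Bernstein positivity ⇒ positivity** at order 4: if every `c⁴_β(a,b,c,e) ≥ 0` then `E₄^{coin q} ≥ 0` for every `q ∈ [0,1]^d`. [this work] -/
theorem sahiE_four_coin_nonneg_of_tc4 {q : Fin d → ℝ} (hq : ∀ i, 0 ≤ q i ∧ q i ≤ 1) {a b c e : Pt d → ℝ}
    (htc : ∀ β : Fin d → ℕ, 0 ≤ tc4 β a b c e) : 0 ≤ sahiE (coinWeight q) 4 ![a, b, c, e] := by
  rw [sahiE_four_coinWeight]
  exact sum_nonneg fun β _ => mul_nonneg (bern4_nonneg hq _) (htc _)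

/-! ### §4 The obligation 4C-SAHI and its reductions -/

/-- **4C-SAHI** (CENSUS §175 / W197i), functions form: for every `d`, every profile and all pointwise nonnegative monotone
`f₀, f₁, f₂, f₃ : {0,1}^d → ℝ`, `0 ≤ c⁴_β(f₀,f₁,f₂,f₃)` — "Sahi's `E₄` is Bernstein-positive in the minimal tensor multidegree `(4,…,4)`".
Evidence: exhaustive on `{0,1}^d` for `d ≤ 4` (2.15·10¹⁰ (multiset, profile) pairs), 10⁹ random pairs beyond, 0 negative.  OPEN — an obligation /
hypothesis, never a fact. [this work; CENSUS §175 W197i] [status: open] -/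
@[conjecture] def FourCopySahi : Prop :=
  ∀ (d : ℕ) (β : Fin d → ℕ) (f₀ f₁ f₂ f₃ : Pt d → ℝ), (∀ x, 0 ≤ f₀ x) → (∀ x, 0 ≤ f₁ x) → (∀ x, 0 ≤ f₂ x) → (∀ x, 0 ≤ f₃ x) →
    Monotone f₀ → Monotone f₁ → Monotone f₂ → Monotone f₃ → 0 ≤ tc4 β f₀ f₁ f₂ f₃

/-- **4C-SAHI ⇒ `C₄` for every product measure on every finite cube.** [this work] -/
theorem sahiPositive_coinWeight_four_of_fourCopySahi (H : FourCopySahi) (d : ℕ) (q : Fin d → ℝ)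
    (hq : ∀ i, 0 ≤ q i ∧ q i ≤ 1) : SahiPositive (coinWeight q) 4 := by
  intro F hF hmono
  have e : F = ![F 0, F 1, F 2, F 3] := by
    ext i x; fin_cases i <;> rfl
  rw [e]
  exact sahiE_four_coin_nonneg_of_tc4 hq fun β =>
    H d β (F 0) (F 1) (F 2) (F 3) (hF 0) (hF 1) (hF 2) (hF 3) (hmono 0) (hmono 1) (hmono 2) (hmono 3)

/-- **4C-SAHI ⇒ Sahi's Conjecture `C₄` for EVERY FKG poset** (underlying independents). [this work; Kahn2022, p. 2 footnote 1] -/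
theorem sahiConjecture_four_of_fourCopySahi (H : FourCopySahi) : SahiConjecture 4 := by
  intro α _ _ μ hμ
  exact SahiPositive.of_isFKGMeasure_of_forall_coinWeight
    (fun m q hq => sahiPositive_coinWeight_four_of_fourCopySahi H m q fun i => ⟨(hq i).1.le, (hq i).2.le⟩) hμ

/-- **4C-SAHI ⇒ `C₃`** (Lieb–Sahi hierarchy `C₄ ⇒ C₃` per weight, `SahiPositive.of_succ`). [this work; LiebSahi2021, p. 3] -/
theorem sahiConjecture_three_of_fourCopySahi (H : FourCopySahi) : SahiConjecture 3 := by
  intro α _ _ μ hμ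
  exact (sahiConjecture_four_of_fourCopySahi H α μ hμ).of_succ hμ.nonneg hμ.sum_eq_one

end

end Summit.CriticalPhenomena.PercolationContinuityZ3.Theorems.SahiThreeCopy
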